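import Literature.NumberTheory.DiophantineGeometry.AbcValuationProductShimuraProofs
import Literature.Barriers.ABC.BakerMethodBoundsStewartYu1991LineRestrictedProofs
import HarnessLib

/-!
# `d(abc) ≪_{ν,ε} rad(abc)^{2+ε}` for `ω(abc) = ν` from `p`-adic estimates of Waldschmidt/Yu-1990
# quality, and `d(abc) ≪_ε rad(abc)^{10/3+ε}` from Pasten's Theorem 16.4 (ii) alone

A *proofs* file (theorems only: no definition, no named fact). H. Pasten, *Shimura curves and the
abc conjecture*, J. Number Theory **254** (2024) = arXiv:1705.09251v4, §§15–16: the printed proof of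
Theorem 16.7 (`d(abc) < K_ε rad(abc)^{8/3+ε}`, the tree's named fact `pasten2024_thm_2_5`) combines
the Shimura-curve engine Theorem 16.4 (ii) for the triples with many prime factors with two inputs
from the theory of linear forms in `p`-adic logarithms: Proposition 15.1 for the triples with
`ω(abc)` bounded, and Lemma 15.2 for the `2`-part `v₂(abc) + 1`. The kernel form of that proof
(`card_divisors_lt_of_thm_16_4_core`, `AbcValuationProductShimuraProofs.lean`) takes these two
inputs as binders; here they are supplied from what summit ABC has PROVED:

* **Small `ω` (in place of Proposition 15.1).** `card_divisors_le_of_w80Shape`: a `p`-adic estimate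
  for rational primes at every prime `p` of the shape
  `ord_p(∏_{q ∈ S} q^{e_q} − 1) < (c₅ #S)^{#S} · p² · (log B + log log A) · log log A · ∏_{q ∈ S} log max(4,q)`
  (`A = max(4, max S)`, `|e_q| ≤ B`, `B ≥ 3`) — verbatim the binder `hW` of the door
  `Literature.Barriers.ABC.stewartYu1991_of_w80Shape`, which the cell `abc-stewartyu` has CLOSED
  (the three residue-class texts `W80ThreeModFour` / `W80OneModFour` / `W80Two` of the route
  `PadicPrimesW80TwoThirds`, Summits side) — gives, for FIXED `ν`, `d(abc) ≤ K_{ν,ε} rad(abc)^{2+ε}`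
  for the abc triples with `ω(abc) = ν`. Proof: the congruences (10)–(12) of Stewart–Yu 1991
  (`padicValRat_route_a/_b`, `le_padicValRat_route_c`: `ord_p` of `c/b − 1`, `c/a − 1`,
  `(a/b)² − 1`) feed `hW` for every `p ∣ abc`, giving `v_p(abc) + 1 ≤ Q · p²` with
  `Q = 3 (max(1,|c₅|) ν)^ν · (log B + log log 4R) log log 4R · ∏_{q ∣ abc} log max(4,q) + 1`,
  `B = 6 log c`; multiplying over `p ∣ abc`, `d(abc) ≤ Q^ν rad²`, and `Q ≪_{ν,η} rad^{3η}` by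
  `∏ log max(4,q) ≤ 3^ν ∏ log q ≪_η 3^ν rad^η` (`exists_prod_log_primeFactors_le_mul_rpow`) and
  `log log c ≪ log rad` (from `hW` itself through the door: `stewartYu1991_of_w80Shape`,
  `log c ≤ κ rad` for all triples, `exists_log_le_mul_rpow_of_stewartYu1991`). The exponent of `p`
  is `2` (Yu 1990 quality), whence `rad²` instead of print's `rad^{1+εν}`; for bounded `ν` this is
  all the proof of Theorem 16.7 needs.
* **The `2`-part (in place of Lemma 15.2).** Trivially `v₂(abc) ≤ log₂(abc) ≤ 3 log₂ c`, and
  `log c ≤ κ_ε rad^{2/3+ε}` (Stewart–Yu 1991, again from `hW` through the door).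

Result: `card_divisors_lt_of_thm_16_4_of_w80Shape` / `exists_card_divisors_lt_of_pastenShimura2024_thm_16_4_of_w80Shape`:
**`d(abc) = ∏_{p ∣ abc}(v_p(abc)+1) < K_ε · rad(abc)^{10/3+ε}` for all abc triples, from Theorem
16.4 (ii) (the typed fact `pastenShimura2024_thm_16_4`) and the binder `hW`** — i.e., for summit ABC,
from the single Shimura-curve fact, everything else being proved in the tree. (With Lemma 15.2 from
`2`-adic estimates of Yu-2007 quality the exponent is print's `8/3 + ε`:
`pasten2024_thm_2_5_of_thm_16_4_of_placeBounds`, `AbcDivisorBoundLinearFormsProofs.lean`.) This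
weaker exponent is NOT a printed statement; it is the printed proof of Theorem 16.7 run with the
tree's proved linear-forms inputs, recorded as a theorem with explicit hypotheses.

## References

* [PastenShimura2024] H. Pasten, J. Number Theory 254 (2024) = arXiv:1705.09251v4 — §15.1
  (Prop. 15.1, Lemma 15.2, p. 47), §16.4 Thm 16.7 with proof (p. 51).
* [StewartYu1991] C. L. Stewart, K. Yu, Math. Ann. 291 (1991) 225–230 — §3, (9)–(14).
* [Waldschmidt1980] M. Waldschmidt, Acta Arith. 37 (1980) — Prop. 3.8 (the shape of `hW`).
-/

noncomputable section

open Finset Real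
open Literature.Barriers.ABC
open Literature.NumberTheory.DiophantineGeometry.Pasten

namespace Literature.NumberTheory.DiophantineGeometry

open Literature.NumberTheory.Automorphic (IsAdmissibleFactorization IsFreyHellegouarch)

/-! ### A polynomial bound `log c ≪ rad` for ALL triples from Stewart–Yu 1991 -/

/-- From `stewartYu1991_upperBound` (`log c ≤ κ rad^{2/3+ε}` for `c ≥ c₀(ε)`): for every `ε > 0`
there is `κ' ≥ 1` with `log c ≤ κ' rad(abc)^{2/3+ε}` for ALL abc triples (the finitely many `c < c₀`
are absorbed into the constant, `rad ≥ 1`). [cite: StewartYu1991, Theorem (p. 226)] -/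
theorem exists_log_le_mul_rpow_of_stewartYu1991 (h : stewartYu1991_upperBound) {ε : ℝ}
    (hε : 0 < ε) :
    ∃ κ : ℝ, 1 ≤ κ ∧ ∀ a b c : ℕ, IsABCTriple a b c →
      Real.log c ≤ κ * (rad a b c : ℝ) ^ (2 / 3 + ε : ℝ) := by
  obtain ⟨κ, c₀, hκ⟩ := h ε hε
  refine ⟨max κ 0 + max c₀ 0 + 1, by
    have := le_max_right κ 0; have := le_max_right c₀ 0; linarith, fun a b c habc => ?_⟩
  have hR1 : (1 : ℝ) ≤ (rad a b c : ℝ) := one_le_rad_real a b c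
  have hRpow : (1 : ℝ) ≤ (rad a b c : ℝ) ^ (2 / 3 + ε : ℝ) := Real.one_le_rpow hR1 (by positivity)
  have hK0 : 0 ≤ max κ 0 + max c₀ 0 + 1 := by
    have := le_max_right κ 0; have := le_max_right c₀ 0; linarith
  by_cases hc : c₀ ≤ (c : ℝ)
  · calc Real.log c ≤ κ * (rad a b c : ℝ) ^ (2 / 3 + ε : ℝ) := hκ a b c habc hc
      _ ≤ (max κ 0 + max c₀ 0 + 1) * (rad a b c : ℝ) ^ (2 / 3 + ε : ℝ) := by
          apply mul_le_mul_of_nonneg_right _ (by positivity)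
          have := le_max_left κ 0; have := le_max_right c₀ 0; linarith
  · rw [not_le] at hc
    have h1 : Real.log c ≤ (c : ℝ) := Real.log_le_self (Nat.cast_nonneg c)
    calc Real.log c ≤ max κ 0 + max c₀ 0 + 1 := by
          have := le_max_left c₀ 0; have := le_max_right κ 0; linarith
      _ ≤ (max κ 0 + max c₀ 0 + 1) * (rad a b c : ℝ) ^ (2 / 3 + ε : ℝ) :=
          le_mul_of_one_le_right hK0 hRpow

/-- `log c ≤ κ · rad(abc)` for all abc triples (`κ ≥ 1`), from `stewartYu1991_upperBound` with
`ε = 1/3`. [cite: StewartYu1991, Theorem (p. 226)] -/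
theorem exists_log_le_mul_rad_of_stewartYu1991 (h : stewartYu1991_upperBound) :
    ∃ κ : ℝ, 1 ≤ κ ∧ ∀ a b c : ℕ, IsABCTriple a b c → Real.log c ≤ κ * (rad a b c : ℝ) := by
  obtain ⟨κ, hκ1, hκ⟩ := exists_log_le_mul_rpow_of_stewartYu1991 h (ε := 1 / 3) (by norm_num)
  refine ⟨κ, hκ1, fun a b c habc => ?_⟩
  have := hκ a b c habc
  have h1 : (rad a b c : ℝ) ^ (2 / 3 + 1 / 3 : ℝ) = (rad a b c : ℝ) := by norm_num
  rwa [h1] at this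

/-! ### One prime of one member, from the Waldschmidt-shape binder -/

section W80

variable (c₅ : ℝ)

/-- **One exponent from the binder `hW`.** If `ord_p x ≤ ord_p(∏_{q ∈ T} q^{e_q} − 1)` (the
congruences (10)–(12) of Stewart–Yu 1991) with `T` a nonempty set of primes not containing `p`,
`|e_q| ≤ B` (`B ≥ 3`), `#T ≤ ν`, `(c₅ n)^n ≤ C_ν` for `n ≤ ν`, `log log A_T ≤ L_R` and
`∏_{q ∈ T} log max(4,q) ≤ Λ`, then `v_p(x) < C_ν · p² · (log B + L_R) L_R · Λ`.
[cite: StewartYu1991, (9)–(12)] -/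
private theorem factorization_lt_of_w80Shape
    (hW : ∀ (p : ℕ), p.Prime → ∀ (S : Finset ℕ), (∀ q ∈ S, q.Prime) → p ∉ S → S.Nonempty →
      ∀ (e : ℕ → ℤ) (B : ℝ), 3 ≤ B → (∀ q ∈ S, (|e q| : ℝ) ≤ B) →
      ∏ q ∈ S, (q : ℚ) ^ e q ≠ 1 →
      (padicValRat p (∏ q ∈ S, (q : ℚ) ^ e q - 1) : ℝ) <
        (c₅ * S.card) ^ S.card * (p : ℝ) ^ 2 *
          ((Real.log B + Real.log (Real.log ((max 4 (S.sup id) : ℕ) : ℝ))) *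
            Real.log (Real.log ((max 4 (S.sup id) : ℕ) : ℝ))) *
          ∏ q ∈ S, Real.log ((max 4 q : ℕ) : ℝ))
    {Cν LR Λ B : ℝ} {ν : ℕ} {T : Finset ℕ} (x : ℕ) (e : ℕ → ℤ) {p : ℕ} (hp : p.Prime)
    (hT : ∀ q ∈ T, q.Prime) (hpT : p ∉ T) (hTne : T.Nonempty) (hTν : T.card ≤ ν)
    (hCν : ∀ n : ℕ, n ≤ ν → (c₅ * n) ^ n ≤ Cν)
    (hB3 : 3 ≤ B) (heB : ∀ q ∈ T, (|e q| : ℝ) ≤ B) (hne1 : ∏ q ∈ T, (q : ℚ) ^ e q ≠ 1)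
    (hLLA : Real.log (Real.log ((max 4 (T.sup id) : ℕ) : ℝ)) ≤ LR)
    (hΛ : ∏ q ∈ T, Real.log ((max 4 q : ℕ) : ℝ) ≤ Λ)
    (hval : (x.factorization p : ℝ) ≤ padicValRat p (∏ q ∈ T, (q : ℚ) ^ e q - 1)) :
    (x.factorization p : ℝ) < Cν * (p : ℝ) ^ 2 * ((Real.log B + LR) * LR) * Λ + 1 := by
  have key := hW p hp T hT hpT hTne e B hB3 heB hne1
  set LLA := Real.log (Real.log ((max 4 (T.sup id) : ℕ) : ℝ)) with hLLAdef
  set PL := ∏ q ∈ T, Real.log ((max 4 q : ℕ) : ℝ) with hPLdef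
  have hLLA0 : 0 ≤ LLA := by
    apply Real.log_nonneg
    rw [← Real.log_exp 1]
    apply Real.log_le_log (Real.exp_pos 1)
    have h4 : (4 : ℝ) ≤ ((max 4 (T.sup id) : ℕ) : ℝ) := by exact_mod_cast le_max_left _ _
    have := Real.exp_one_lt_d9; linarith
  have hLR0 : 0 ≤ LR := hLLA0.trans hLLA
  have hlogB : 0 ≤ Real.log B := Real.log_nonneg (by linarith)
  have hPL1 : 1 ≤ PL := one_le_prod_log_max_four T
  have hPL0 : 0 ≤ PL := zero_le_one.trans hPL1
  have hp0 : (0 : ℝ) ≤ (p : ℝ) ^ 2 := by positivity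
  have hCν0 : 0 ≤ Cν := by
    have h0 := hCν 0 (Nat.zero_le _)
    simp only [Nat.cast_zero, mul_zero, pow_zero] at h0
    exact zero_le_one.trans h0
  have hLl0 : 0 ≤ (Real.log B + LLA) * LLA := mul_nonneg (by linarith) hLLA0
  have hL0 : 0 ≤ (Real.log B + LR) * LR := mul_nonneg (by linarith) hLR0
  -- `(c₅ n)^n ≤ C_ν`, the tail being nonnegative
  have hc : (c₅ * T.card) ^ T.card ≤ Cν := hCν T.card hTν
  have htail : 0 ≤ (p : ℝ) ^ 2 * ((Real.log B + LLA) * LLA) * PL :=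
    mul_nonneg (mul_nonneg hp0 hLl0) hPL0
  have h1 : (c₅ * T.card) ^ T.card * (p : ℝ) ^ 2 * ((Real.log B + LLA) * LLA) * PL ≤
      Cν * (p : ℝ) ^ 2 * ((Real.log B + LLA) * LLA) * PL := by
    have := mul_le_mul_of_nonneg_right hc htail
    calc (c₅ * T.card) ^ T.card * (p : ℝ) ^ 2 * ((Real.log B + LLA) * LLA) * PL
        = (c₅ * T.card) ^ T.card * ((p : ℝ) ^ 2 * ((Real.log B + LLA) * LLA) * PL) := by ring
      _ ≤ Cν * ((p : ℝ) ^ 2 * ((Real.log B + LLA) * LLA) * PL) := this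
      _ = _ := by ring
  have h2 : (Real.log B + LLA) * LLA ≤ (Real.log B + LR) * LR :=
    mul_le_mul (by linarith) hLLA hLLA0 (by linarith)
  have hCp : 0 ≤ Cν * (p : ℝ) ^ 2 := mul_nonneg hCν0 hp0
  have h3 : Cν * (p : ℝ) ^ 2 * ((Real.log B + LLA) * LLA) * PL ≤
      Cν * (p : ℝ) ^ 2 * ((Real.log B + LR) * LR) * Λ :=
    mul_le_mul (mul_le_mul_of_nonneg_left h2 hCp) hΛ hPL0 (mul_nonneg hCp hL0)
  calc (x.factorization p : ℝ) ≤ _ := hval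
    _ < _ := key
    _ ≤ Cν * (p : ℝ) ^ 2 * ((Real.log B + LR) * LR) * Λ := h1.trans h3
    _ ≤ _ := by linarith

/-! ### The small-`ω` divisor bound -/

/-- **`d(abc) ≪_{ν,ε} rad(abc)^{2+ε}` for the abc triples with `ω(abc) = ν`, from `p`-adic estimates
for rational primes of Waldschmidt/Yu-1990 quality** (the binder `hW` of
`Literature.Barriers.ABC.stewartYu1991_of_w80Shape`; module docstring for the proof). This replaces
Pasten's Proposition 15.1 (`rad^{1+εν}`, from Yu's bound linear in `p`) in the small-`ω` step of the
proof of Theorem 16.7 when only the exponent `p²` is available.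
[cite: PastenShimura2024, Proposition 15.1 and Theorem 16.7 (proof) (§15.1 p. 47, §16.4 p. 51, arXiv:1705.09251v4)]
[cite: StewartYu1991, §3 (9)–(14)] -/
theorem card_divisors_le_of_w80Shape
    (hW : ∀ (p : ℕ), p.Prime → ∀ (S : Finset ℕ), (∀ q ∈ S, q.Prime) → p ∉ S → S.Nonempty →
      ∀ (e : ℕ → ℤ) (B : ℝ), 3 ≤ B → (∀ q ∈ S, (|e q| : ℝ) ≤ B) →
      ∏ q ∈ S, (q : ℚ) ^ e q ≠ 1 →
      (padicValRat p (∏ q ∈ S, (q : ℚ) ^ e q - 1) : ℝ) <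
        (c₅ * S.card) ^ S.card * (p : ℝ) ^ 2 *
          ((Real.log B + Real.log (Real.log ((max 4 (S.sup id) : ℕ) : ℝ))) *
            Real.log (Real.log ((max 4 (S.sup id) : ℕ) : ℝ))) *
          ∏ q ∈ S, Real.log ((max 4 q : ℕ) : ℝ))
    (ε : ℝ) (hε : 0 < ε) (ν : ℕ) :
    ∃ K : ℝ, 0 < K ∧ ∀ a b c : ℕ, IsABCTriple a b c → (a * b * c).primeFactors.card = ν →
      ((a * b * c).divisors.card : ℝ) ≤ K * (rad a b c : ℝ) ^ (2 + ε) := by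
  classical
  -- `ν = 0` does not occur
  rcases Nat.eq_zero_or_pos ν with rfl | hνpos
  · refine ⟨1, one_pos, fun a b c h hν => ?_⟩
    exfalso
    rw [Finset.card_eq_zero, Nat.primeFactors_eq_empty] at hν
    have := h.two_le_mul
    omega
  -- constants (opaque names with defining equations)
  obtain ⟨κ₁, hκ₁1, hκ₁⟩ := exists_log_le_mul_rad_of_stewartYu1991 (stewartYu1991_of_w80Shape c₅ hW)
  have hν1 : (1 : ℝ) ≤ ν := by exact_mod_cast hνpos
  obtain ⟨η, hηdef⟩ : ∃ η : ℝ, η = ε / (3 * ν) := ⟨_, rfl⟩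
  have hη : 0 < η := by rw [hηdef]; positivity
  have h3ην : 3 * η * ν = ε := by rw [hηdef]; field_simp
  obtain ⟨CL, hCL1, hCL⟩ := exists_prod_log_primeFactors_le_mul_rpow hη
  have hCL0 : 0 ≤ CL := zero_le_one.trans hCL1
  obtain ⟨Cmax, hCmaxdef⟩ : ∃ Cmax : ℝ, Cmax = max 1 |c₅| := ⟨_, rfl⟩
  have hCmax1 : 1 ≤ Cmax := by rw [hCmaxdef]; exact le_max_left _ _
  have hc₅C : |c₅| ≤ Cmax := by rw [hCmaxdef]; exact le_max_right _ _
  obtain ⟨Cν, hCνdef⟩ : ∃ Cν : ℝ, Cν = (Cmax * ν) ^ ν := ⟨_, rfl⟩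
  have hCmaxν : 1 ≤ Cmax * ν := one_le_mul_of_one_le_of_one_le hCmax1 hν1
  have hCν1 : 1 ≤ Cν := by rw [hCνdef]; exact one_le_pow₀ hCmaxν
  have hCν0 : 0 ≤ Cν := zero_le_one.trans hCν1
  have hCνle : ∀ n : ℕ, n ≤ ν → (c₅ * n) ^ n ≤ Cν := fun n hn => by
    rw [hCνdef]
    exact (mul_pow_le_mul_pow_of_abs_le hc₅C hn).trans (pow_le_pow_right₀ hCmaxν hn)
  obtain ⟨c₀, hc₀def⟩ : ∃ c₀ : ℝ, c₀ = Real.log (9 * κ₁) + 2 := ⟨_, rfl⟩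
  have hc₀2 : 2 ≤ c₀ := by
    have : 0 ≤ Real.log (9 * κ₁) := Real.log_nonneg (by linarith)
    rw [hc₀def]; linarith
  obtain ⟨Lη, hLηdef⟩ : ∃ Lη : ℝ, Lη = (c₀ + 2 / η) ^ 2 := ⟨_, rfl⟩
  have hLη0 : 0 ≤ Lη := by rw [hLηdef]; positivity
  obtain ⟨Q₀, hQ₀def⟩ : ∃ Q₀ : ℝ, Q₀ = 3 * Cν * Lη * (3 ^ ν * CL) + 1 := ⟨_, rfl⟩
  have hQ₀aux : 0 ≤ 3 * Cν * Lη * (3 ^ ν * CL) :=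
    mul_nonneg (mul_nonneg (mul_nonneg (by norm_num) hCν0) hLη0)
      (mul_nonneg (pow_nonneg (by norm_num) ν) hCL0)
  have hQ₀1 : 1 ≤ Q₀ := by rw [hQ₀def]; linarith
  have hK1 : 1 ≤ Q₀ ^ ν := one_le_pow₀ hQ₀1
  have hK0 : 0 ≤ Q₀ ^ ν := zero_le_one.trans hK1
  refine ⟨2 * Q₀ ^ ν, by linarith, fun a b c h hν => ?_⟩
  obtain ⟨ha, hb, habc, hcop⟩ := id h
  have ha0 : a ≠ 0 := ha.ne'
  have hb0 : b ≠ 0 := hb.ne'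
  have hc0 : c ≠ 0 := by omega
  have h0 := h.mul_ne_zero
  have hbc : b.Coprime c := coprime_right_of_isABCTriple h
  have hac : a.Coprime c := coprime_left_of_isABCTriple h
  -- the radical as an opaque real `R`
  obtain ⟨R, hRdef⟩ : ∃ R : ℝ, R = (rad a b c : ℝ) := ⟨_, rfl⟩
  rw [← hRdef]
  have hR1 : 1 ≤ R := by rw [hRdef]; exact one_le_rad_real a b c
  have hR0 : 0 < R := by linarith
  have hRε : 1 ≤ R ^ (2 + ε) := Real.one_le_rpow hR1 (by linarith)
  -- the triple `1 + 1 = 2` (the only one with `a = b`)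
  by_cases hab : a = b
  · subst hab
    have ha1 : a = 1 := by
      have h1 := Nat.Coprime.gcd_eq_one hcop
      rwa [Nat.gcd_self] at h1
    subst ha1
    have hc2 : c = 2 := by omega
    subst hc2
    have hd : ((1 : ℕ) * 1 * 2).divisors.card = 2 := by
      rw [show (1 : ℕ) * 1 * 2 = 2 by norm_num, Nat.Prime.divisors Nat.prime_two, card_pair (by norm_num)]
    rw [hd]
    push_cast
    have : (1 : ℝ) ≤ Q₀ ^ ν * R ^ (2 + ε) := one_le_mul_of_one_le_of_one_le hK1 hRε
    linarith
  -- generic triple: `c ≥ 3`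
  have hc3 : 3 ≤ c := by
    rcases Nat.lt_or_gt_of_ne hab with hlt | hlt <;> omega
  have hc3r : (3 : ℝ) ≤ c := by exact_mod_cast hc3
  have hlogc1 : 1 ≤ Real.log c := by
    rw [← Real.log_exp 1]
    exact Real.log_le_log (Real.exp_pos 1) (by have := Real.exp_one_lt_d9; linarith)
  obtain ⟨B, hBdef⟩ : ∃ B : ℝ, B = 6 * Real.log c := ⟨_, rfl⟩
  have hB3 : 3 ≤ B := by rw [hBdef]; linarith
  have hlogB : 0 ≤ Real.log B := Real.log_nonneg (by linarith)
  -- the set of primes and the radical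
  set S := (a * b * c).primeFactors with hSdef
  have hradS : rad a b c = ∏ q ∈ S, q := by rw [rad_def, Nat.radical_eq_prod_primeFactors]
  have hradpos : 0 < rad a b c := by rw [rad_def]; exact Nat.radical_pos _
  have hsubR : ∀ U : Finset ℕ, U ⊆ S → ((∏ q ∈ U, q : ℕ) : ℝ) ≤ R := by
    intro U hU
    have h1 : ∏ q ∈ U, q ∣ ∏ q ∈ S, q := prod_dvd_prod_of_subset U S _ hU
    have h2 : ∏ q ∈ U, q ≤ rad a b c := by rw [hradS]; exact Nat.le_of_dvd (hradS ▸ hradpos) h1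
    rw [hRdef]; exact_mod_cast h2
  have hqR : ∀ q ∈ S, (q : ℝ) ≤ R := by
    intro q hq
    have := hsubR {q} (singleton_subset_iff.mpr hq)
    rwa [prod_singleton] at this
  have hSprime : ∀ q ∈ S, q.Prime := fun q hq => Nat.prime_of_mem_primeFactors hq
  -- `log log A_T ≤ L_R := log log (4R)` for `T ⊆ S` nonempty
  obtain ⟨LR, hLRdef⟩ : ∃ LR : ℝ, LR = Real.log (Real.log (4 * R)) := ⟨_, rfl⟩
  have hLLA : ∀ T : Finset ℕ, T ⊆ S → T.Nonempty →
      Real.log (Real.log ((max 4 (T.sup id) : ℕ) : ℝ)) ≤ LR := by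
    intro T hT hTne
    have hA4 : (4 : ℝ) ≤ ((max 4 (T.sup id) : ℕ) : ℝ) := by exact_mod_cast le_max_left _ _
    have hAR : ((max 4 (T.sup id) : ℕ) : ℝ) ≤ 4 * R := by
      have : ((max 4 (T.sup id) : ℕ) : ℝ) = max (4 : ℝ) ((T.sup id : ℕ) : ℝ) := by push_cast; rfl
      rw [this]
      refine max_le (by linarith) ?_
      obtain ⟨q, hq, hsup⟩ := exists_mem_eq_sup T hTne id
      rw [hsup]
      exact (hqR q (hT hq)).trans (by linarith)
    have hlogA : 0 < Real.log ((max 4 (T.sup id) : ℕ) : ℝ) := Real.log_pos (by linarith)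
    rw [hLRdef]
    exact Real.log_le_log hlogA (Real.log_le_log (by linarith) hAR)
  have hLLA0 : ∀ T : Finset ℕ, 0 ≤ Real.log (Real.log ((max 4 (T.sup id) : ℕ) : ℝ)) := by
    intro T
    apply Real.log_nonneg
    rw [← Real.log_exp 1]
    apply Real.log_le_log (Real.exp_pos 1)
    have h4 : (4 : ℝ) ≤ ((max 4 (T.sup id) : ℕ) : ℝ) := by exact_mod_cast le_max_left _ _
    have := Real.exp_one_lt_d9; linarith
  -- `∏_{q ∈ T} log max(4,q) ≤ Λ := ∏_{q ∈ S} log max(4,q)` for `T ⊆ S`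
  obtain ⟨Λ, hΛdef⟩ : ∃ Λ : ℝ, Λ = ∏ q ∈ S, Real.log ((max 4 q : ℕ) : ℝ) := ⟨_, rfl⟩
  have hΛ1 : 1 ≤ Λ := by rw [hΛdef]; exact one_le_prod_log_max_four S
  have hΛ0 : 0 ≤ Λ := zero_le_one.trans hΛ1
  have hΛT : ∀ T : Finset ℕ, T ⊆ S → ∏ q ∈ T, Real.log ((max 4 q : ℕ) : ℝ) ≤ Λ := by
    intro T hT
    rw [hΛdef, ← prod_sdiff hT]
    exact le_mul_of_one_le_left (zero_le_one.trans (one_le_prod_log_max_four T))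
      (one_le_prod_log_max_four (S \ T))
  -- the three sets of primes of the pairs, inside `S`
  have hSab : (a * b).primeFactors ⊆ S := by
    rw [hSdef, Nat.primeFactors_mul (mul_ne_zero ha0 hb0) hc0]; exact subset_union_left
  have hScb : (c * b).primeFactors ⊆ S := by
    intro q hq
    rw [Nat.primeFactors_mul hc0 hb0, mem_union] at hq
    rw [hSdef, Nat.primeFactors_mul (mul_ne_zero ha0 hb0) hc0, Nat.primeFactors_mul ha0 hb0,
      mem_union, mem_union]
    tauto
  have hSca : (c * a).primeFactors ⊆ S := by
    intro q hq
    rw [Nat.primeFactors_mul hc0 ha0, mem_union] at hq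
    rw [hSdef, Nat.primeFactors_mul (mul_ne_zero ha0 hb0) hc0, Nat.primeFactors_mul ha0 hb0,
      mem_union, mem_union]
    tauto
  have hcardT : ∀ T : Finset ℕ, T ⊆ S → T.card ≤ ν := fun T hT => (card_le_card hT).trans hν.le
  have hcb1 : 1 < c * b := by have := Nat.le_mul_of_pos_right c hb; omega
  have hca1 : 1 < c * a := by have := Nat.le_mul_of_pos_right c ha; omega
  have hab1 : 1 < a * b := by
    rcases Nat.lt_or_gt_of_ne hab with hlt | hlt
    · have := Nat.le_mul_of_pos_left b ha; omega
    · have := Nat.le_mul_of_pos_right a hb; omega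
  have hTne_cb : (c * b).primeFactors.Nonempty := Nat.nonempty_primeFactors.mpr hcb1
  have hTne_ca : (c * a).primeFactors.Nonempty := Nat.nonempty_primeFactors.mpr hca1
  have hTne_ab : (a * b).primeFactors.Nonempty := Nat.nonempty_primeFactors.mpr hab1
  have hLR0 : 0 ≤ LR := (hLLA0 _).trans (hLLA _ hScb hTne_cb)
  have hL0 : 0 ≤ (Real.log B + LR) * LR := mul_nonneg (by linarith) hLR0
  -- exponent bounds `|e_q| ≤ B = 6 log c`
  have hac_le : a ≤ c := by omega
  have hbc_le : b ≤ c := by omega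
  have heab : ∀ q ∈ (a * b).primeFactors, |(((2 * expDiff a b q : ℤ)) : ℝ)| ≤ B := by
    intro q hq
    have hq' := abs_expDiff_le ha0 hb0 hcop hac_le hbc_le q (Nat.prime_of_mem_primeFactors hq)
    have hcast : (((2 * expDiff a b q : ℤ)) : ℝ) = 2 * ((expDiff a b q : ℤ) : ℝ) := by
      push_cast; ring
    rw [hcast, abs_mul, abs_two, hBdef]
    linarith
  have heca : ∀ q ∈ (c * a).primeFactors, (|expDiff c a q| : ℝ) ≤ B := by
    intro q hq
    have := abs_expDiff_le hc0 ha0 hac.symm le_rfl hac_le q (Nat.prime_of_mem_primeFactors hq)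
    rw [hBdef]; linarith
  have hecb : ∀ q ∈ (c * b).primeFactors, (|expDiff c b q| : ℝ) ≤ B := by
    intro q hq
    have := abs_expDiff_le hc0 hb0 hbc.symm le_rfl hbc_le q (Nat.prime_of_mem_primeFactors hq)
    rw [hBdef]; linarith
  -- the uniform majorant of `v_p(abc) + 1`: `Q · p²`, `Q = 3 C_ν (log B + L_R) L_R Λ + 1`
  obtain ⟨Q, hQdef⟩ : ∃ Q : ℝ, Q = 3 * Cν * ((Real.log B + LR) * LR) * Λ + 1 := ⟨_, rfl⟩
  have hQaux : 0 ≤ 3 * Cν * ((Real.log B + LR) * LR) * Λ :=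
    mul_nonneg (mul_nonneg (mul_nonneg (by norm_num) hCν0) hL0) hΛ0
  have hQ1 : 1 ≤ Q := by rw [hQdef]; linarith
  have hQ0 : 0 ≤ Q := zero_le_one.trans hQ1
  have hU : ∀ p ∈ S, (((a * b * c).factorization p : ℕ) : ℝ) + 1 ≤ Q * (p : ℝ) ^ 2 := by
    intro p hp
    have hpp : p.Prime := hSprime p hp
    have hp2 : (2 : ℝ) ≤ p := by exact_mod_cast hpp.two_le
    have hp4 : (4 : ℝ) ≤ (p : ℝ) ^ 2 := by
      rw [show (4 : ℝ) = 2 ^ 2 by norm_num]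
      exact pow_le_pow_left₀ (by norm_num) hp2 2
    obtain ⟨U, hUdef⟩ : ∃ U : ℝ, U = Cν * (p : ℝ) ^ 2 * ((Real.log B + LR) * LR) * Λ + 1 :=
      ⟨_, rfl⟩
    have hU0 : 0 ≤ Cν * (p : ℝ) ^ 2 * ((Real.log B + LR) * LR) * Λ :=
      mul_nonneg (mul_nonneg (mul_nonneg hCν0 (by positivity)) hL0) hΛ0
    have hU1 : 0 ≤ U := by rw [hUdef]; linarith
    -- each member contributes at most `U`
    have hva : (a.factorization p : ℝ) ≤ U := by
      by_cases hpa : p ∈ a.primeFactors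
      · have hpT : p ∉ (c * b).primeFactors := by
          intro hmem
          have hpcb : p ∣ c * b := Nat.dvd_of_mem_primeFactors hmem
          have hpa' : p ∣ a := Nat.dvd_of_mem_primeFactors hpa
          have hcopr : a.Coprime (c * b) := Nat.Coprime.mul_right hac hcop
          exact hpp.one_lt.ne' (Nat.eq_one_of_dvd_coprimes hcopr hpa' hpcb)
        rw [hUdef]
        exact (factorization_lt_of_w80Shape c₅ hW a (expDiff c b) hpp
          (fun q hq => Nat.prime_of_mem_primeFactors hq) hpT hTne_cb (hcardT _ hScb) hCνle hB3 hecb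
          (prod_zpow_expDiff_ne_one hc0 hb0 hbc.symm (by omega)) (hLLA _ hScb hTne_cb) (hΛT _ hScb)
          (by exact_mod_cast (padicValRat_route_a h hpa).symm.le)).le
      · have : a.factorization p = 0 := by
          rw [← Finsupp.notMem_support_iff, Nat.support_factorization]; exact hpa
        rw [this, Nat.cast_zero]; exact hU1
    have hvb : (b.factorization p : ℝ) ≤ U := by
      by_cases hpb : p ∈ b.primeFactors
      · have hpT : p ∉ (c * a).primeFactors := by
          intro hmem
          have hpca : p ∣ c * a := Nat.dvd_of_mem_primeFactors hmem
          have hpb' : p ∣ b := Nat.dvd_of_mem_primeFactors hpb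
          have hcopr : b.Coprime (c * a) := Nat.Coprime.mul_right hbc hcop.symm
          exact hpp.one_lt.ne' (Nat.eq_one_of_dvd_coprimes hcopr hpb' hpca)
        rw [hUdef]
        exact (factorization_lt_of_w80Shape c₅ hW b (expDiff c a) hpp
          (fun q hq => Nat.prime_of_mem_primeFactors hq) hpT hTne_ca (hcardT _ hSca) hCνle hB3 heca
          (prod_zpow_expDiff_ne_one hc0 ha0 hac.symm (by omega)) (hLLA _ hSca hTne_ca) (hΛT _ hSca)
          (by exact_mod_cast (padicValRat_route_b h hpb).symm.le)).le
      · have : b.factorization p = 0 := by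
          rw [← Finsupp.notMem_support_iff, Nat.support_factorization]; exact hpb
        rw [this, Nat.cast_zero]; exact hU1
    have hvc : (c.factorization p : ℝ) ≤ U := by
      by_cases hpc : p ∈ c.primeFactors
      · have hpT : p ∉ (a * b).primeFactors := by
          intro hmem
          have hpab : p ∣ a * b := Nat.dvd_of_mem_primeFactors hmem
          have hpc' : p ∣ c := Nat.dvd_of_mem_primeFactors hpc
          have hcopr : c.Coprime (a * b) := Nat.Coprime.mul_right hac.symm hbc.symm
          exact hpp.one_lt.ne' (Nat.eq_one_of_dvd_coprimes hcopr hpc' hpab)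
        rw [hUdef]
        exact (factorization_lt_of_w80Shape c₅ hW c (fun q => 2 * expDiff a b q) hpp
          (fun q hq => Nat.prime_of_mem_primeFactors hq) hpT hTne_ab (hcardT _ hSab) hCνle hB3 heab
          (prod_zpow_two_mul_expDiff_ne_one ha0 hb0 hcop hab) (hLLA _ hSab hTne_ab) (hΛT _ hSab)
          (le_padicValRat_route_c h hab hpc)).le
      · have : c.factorization p = 0 := by
          rw [← Finsupp.notMem_support_iff, Nat.support_factorization]; exact hpc
        rw [this, Nat.cast_zero]; exact hU1
    have hsum : (a * b * c).factorization p =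
        a.factorization p + b.factorization p + c.factorization p := by
      rw [Nat.factorization_mul (mul_ne_zero ha0 hb0) hc0, Nat.factorization_mul ha0 hb0]; rfl
    rw [hsum]
    push_cast
    have h3U : 3 * U + 1 ≤ Q * (p : ℝ) ^ 2 := by
      have hexp : Q * (p : ℝ) ^ 2 =
          3 * (Cν * (p : ℝ) ^ 2 * ((Real.log B + LR) * LR) * Λ) + (p : ℝ) ^ 2 := by
        rw [hQdef]; ring
      rw [hexp, hUdef]
      linarith
    linarith
  -- `d(abc) = ∏ (v_p + 1) ≤ Q^ν R²`
  have hd : ((a * b * c).divisors.card : ℝ) ≤ Q ^ ν * R ^ 2 := by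
    rw [Nat.card_divisors h0, Nat.cast_prod]
    calc ∏ p ∈ S, ((((a * b * c).factorization p + 1 : ℕ)) : ℝ)
        ≤ ∏ p ∈ S, Q * (p : ℝ) ^ 2 := by
          refine prod_le_prod (fun p _ => by positivity) fun p hp => ?_
          have := hU p hp
          push_cast at this ⊢
          exact this
      _ = Q ^ ν * R ^ 2 := by
          rw [prod_mul_distrib, prod_const, hν, prod_pow, hRdef, hradS]
          push_cast
          ring
  -- absorptions: `Λ ≤ 3^ν C_L R^η`, `(log B + L_R) L_R ≤ L_η R^{2η}`
  have hΛle : Λ ≤ 3 ^ ν * CL * R ^ η := by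
    have h1 : Λ ≤ ∏ q ∈ S, 3 * Real.log (q : ℝ) := by
      rw [hΛdef]
      refine prod_le_prod (fun q _ => Real.log_nonneg (by
        exact_mod_cast le_max_of_le_left (by norm_num))) fun q hq => ?_
      have hq2 : (2 : ℝ) ≤ q := by exact_mod_cast (hSprime q hq).two_le
      have hlog2 : (0.6931471803 : ℝ) < Real.log 2 := Real.log_two_gt_d9
      have hlogq : Real.log 2 ≤ Real.log q := Real.log_le_log two_pos hq2
      by_cases hq4 : q ≤ 4
      · have : ((max 4 q : ℕ) : ℝ) = 4 := by
          rw [max_eq_left hq4]; norm_num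
        rw [this, show (4 : ℝ) = 2 ^ 2 by norm_num, Real.log_pow]
        push_cast
        linarith
      · have : ((max 4 q : ℕ) : ℝ) = q := by
          rw [max_eq_right (by omega)]
        rw [this]
        linarith
    have h2 : ∏ q ∈ S, 3 * Real.log (q : ℝ) = 3 ^ ν * ∏ q ∈ S, Real.log (q : ℝ) := by
      rw [prod_mul_distrib, prod_const, hν]
    have h3 : ∏ q ∈ S, Real.log (q : ℝ) ≤ CL * R ^ η := by
      have := hCL (a * b * c)
      have hcast : (∏ p ∈ (a * b * c).primeFactors, (p : ℝ)) = R := by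
        rw [hRdef, hradS, Nat.cast_prod]
      rwa [hcast] at this
    calc Λ ≤ 3 ^ ν * ∏ q ∈ S, Real.log (q : ℝ) := h1.trans h2.le
      _ ≤ 3 ^ ν * (CL * R ^ η) := mul_le_mul_of_nonneg_left h3 (by positivity)
      _ = 3 ^ ν * CL * R ^ η := by ring
  have hLle : (Real.log B + LR) * LR ≤ Lη * R ^ (2 * η) := by
    -- `log B ≤ log(9κ₁) + log R`, `L_R ≤ log(4R) − 1 ≤ 2 + log R`, `log R ≤ R^η/η`
    have hlogR0 : 0 ≤ Real.log R := Real.log_nonneg hR1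
    have hlogRη : Real.log R ≤ R ^ η / η := Real.log_le_rpow_div hR0.le hη
    have hRη1 : 1 ≤ R ^ η := Real.one_le_rpow hR1 hη.le
    have hB : Real.log B ≤ Real.log (9 * κ₁) + Real.log R := by
      have h1 : B ≤ 9 * κ₁ * R := by
        have h2 := hκ₁ a b c h
        rw [← hRdef] at h2
        have h3 : R ≤ κ₁ * R := le_mul_of_one_le_left hR0.le hκ₁1
        rw [hBdef]; linarith
      calc Real.log B ≤ Real.log (9 * κ₁ * R) := Real.log_le_log (by linarith) h1
        _ = Real.log (9 * κ₁) + Real.log R := Real.log_mul (by positivity) hR0.ne'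
    have hLR : LR ≤ 2 + Real.log R := by
      have h4R : 0 < 4 * R := by positivity
      have h2 : 0 < Real.log (4 * R) := Real.log_pos (by linarith)
      have hlog4 : Real.log 4 ≤ 3 := by
        have := Real.log_le_sub_one_of_pos (show (0:ℝ) < 4 by norm_num); linarith
      rw [hLRdef]
      calc Real.log (Real.log (4 * R)) ≤ Real.log (4 * R) - 1 := Real.log_le_sub_one_of_pos h2
        _ = Real.log 4 + Real.log R - 1 := by rw [Real.log_mul (by norm_num) hR0.ne']
        _ ≤ 2 + Real.log R := by linarith
    have hsum : Real.log B + LR ≤ (c₀ + 2 / η) * R ^ η := by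
      have h9 : 0 ≤ Real.log (9 * κ₁) := Real.log_nonneg (by linarith)
      have hc₀R : Real.log (9 * κ₁) + 2 ≤ (Real.log (9 * κ₁) + 2) * R ^ η :=
        le_mul_of_one_le_right (by linarith) hRη1
      calc Real.log B + LR ≤ Real.log (9 * κ₁) + 2 + 2 * Real.log R := by linarith
        _ ≤ (Real.log (9 * κ₁) + 2) * R ^ η + 2 * (R ^ η / η) := by linarith
        _ = (c₀ + 2 / η) * R ^ η := by rw [hc₀def]; ring
    have hLR' : LR ≤ (c₀ + 2 / η) * R ^ η := le_trans (by linarith) hsum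
    have hc₀η : 0 ≤ (c₀ + 2 / η) * R ^ η := hLR0.trans hLR'
    calc (Real.log B + LR) * LR ≤ ((c₀ + 2 / η) * R ^ η) * ((c₀ + 2 / η) * R ^ η) :=
          mul_le_mul hsum hLR' hLR0 hc₀η
      _ = Lη * (R ^ η * R ^ η) := by rw [hLηdef]; ring
      _ = Lη * R ^ (2 * η) := by rw [← Real.rpow_add hR0]; ring_nf
  -- `Q ≤ Q₀ R^{3η}`
  have hR3η : 1 ≤ R ^ (3 * η) := Real.one_le_rpow hR1 (by positivity)
  have hQle : Q ≤ Q₀ * R ^ (3 * η) := by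
    have h1 : ((Real.log B + LR) * LR) * Λ ≤ (Lη * R ^ (2 * η)) * (3 ^ ν * CL * R ^ η) :=
      mul_le_mul hLle hΛle hΛ0 (mul_nonneg hLη0 (by positivity))
    have h2 : R ^ (2 * η) * R ^ η = R ^ (3 * η) := by rw [← Real.rpow_add hR0]; ring_nf
    have h3 : 0 ≤ 3 * Cν := by positivity
    calc Q = 3 * Cν * (((Real.log B + LR) * LR) * Λ) + 1 := by rw [hQdef]; ring
      _ ≤ 3 * Cν * ((Lη * R ^ (2 * η)) * (3 ^ ν * CL * R ^ η)) + 1 := by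
          have := mul_le_mul_of_nonneg_left h1 h3
          linarith
      _ = 3 * Cν * Lη * (3 ^ ν * CL) * (R ^ (2 * η) * R ^ η) + 1 := by ring
      _ = 3 * Cν * Lη * (3 ^ ν * CL) * R ^ (3 * η) + 1 := by rw [h2]
      _ ≤ 3 * Cν * Lη * (3 ^ ν * CL) * R ^ (3 * η) + R ^ (3 * η) := by linarith
      _ = Q₀ * R ^ (3 * η) := by rw [hQ₀def]; ring
  -- conclusion
  have hQν : Q ^ ν ≤ Q₀ ^ ν * R ^ ε := by
    calc Q ^ ν ≤ (Q₀ * R ^ (3 * η)) ^ ν := pow_le_pow_left₀ hQ0 hQle ν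
      _ = Q₀ ^ ν * (R ^ (3 * η)) ^ ν := mul_pow _ _ _
      _ = Q₀ ^ ν * R ^ ε := by
          rw [← Real.rpow_natCast (R ^ (3 * η)) ν, ← Real.rpow_mul hR0.le, h3ην]
  have hfin : (0 : ℝ) ≤ Q₀ ^ ν * R ^ (2 + ε) := by positivity
  calc ((a * b * c).divisors.card : ℝ) ≤ Q ^ ν * R ^ 2 := hd
    _ ≤ (Q₀ ^ ν * R ^ ε) * R ^ 2 := mul_le_mul_of_nonneg_right hQν (by positivity)
    _ = Q₀ ^ ν * R ^ (2 + ε) := by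
        rw [show (2 : ℝ) + ε = ε + 2 by ring, Real.rpow_add hR0, Real.rpow_two]; ring
    _ ≤ 2 * Q₀ ^ ν * R ^ (2 + ε) := by linarith

/-! ### `d(abc) ≪ rad(abc)^{10/3+ε}` from Theorem 16.4 (ii) and the Waldschmidt-shape binder -/

/-- **`d(abc) < K_ε rad(abc)^{10/3+ε}` from Theorem 16.4 (ii) and `p`-adic estimates for rational
primes of Waldschmidt/Yu-1990 quality** (binder `hW` of `stewartYu1991_of_w80Shape`): the printed
proof of Theorem 16.7 (`card_divisors_lt_of_thm_16_4_core`) with the small-`ω` input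
`card_divisors_le_of_w80Shape` (`rad^{2+ε}`) and the `2`-part from Stewart–Yu 1991
(`v₂(abc) ≤ 3 log₂ c`, `log c ≪_ε rad^{2/3+ε}`, `card_divisors_lt_of_thm_16_4_of_logBound` with
`θ = 2/3 + ε/2`). For summit ABC the binder `hW` is PROVED (route `PadicPrimesW80TwoThirds`), so this
bound rests on Theorem 16.4 (ii) alone. [cite: PastenShimura2024, Theorem 16.7 (proof, §16.4, arXiv:1705.09251v4 p. 51)]
[cite: StewartYu1991, Theorem (p. 226) and §3] -/
theorem card_divisors_lt_of_thm_16_4_of_w80Shape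
    (hW : ∀ (p : ℕ), p.Prime → ∀ (S : Finset ℕ), (∀ q ∈ S, q.Prime) → p ∉ S → S.Nonempty →
      ∀ (e : ℕ → ℤ) (B : ℝ), 3 ≤ B → (∀ q ∈ S, (|e q| : ℝ) ≤ B) →
      ∏ q ∈ S, (q : ℚ) ^ e q ≠ 1 →
      (padicValRat p (∏ q ∈ S, (q : ℚ) ^ e q - 1) : ℝ) <
        (c₅ * S.card) ^ S.card * (p : ℝ) ^ 2 *
          ((Real.log B + Real.log (Real.log ((max 4 (S.sup id) : ℕ) : ℝ))) *
            Real.log (Real.log ((max 4 (S.sup id) : ℕ) : ℝ))) *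
          ∏ q ∈ S, Real.log ((max 4 q : ℕ) : ℝ))
    (h164 : ∀ ε : ℝ, 0 < ε → ∃ N₀ : ℕ, ∀ (W : WeierstrassCurve ℚ) [W.IsElliptic],
      IsFreyHellegouarch W → N₀ ≤ W.conductorNorm ℤ →
        ∀ D M : ℕ, IsAdmissibleFactorization (W.conductorNorm ℤ) D M →
          2 ≤ (M.primeFactors.erase 2).card →
            ((∏ p ∈ D.primeFactors, (W.minimalDiscriminantNorm ℤ).factorization p : ℕ) : ℝ)
              < (W.conductorNorm ℤ : ℝ) ^ ((8 : ℝ) / 3 + ε) * (M : ℝ))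
    (ε : ℝ) (hε : 0 < ε) :
    ∃ K : ℝ, 0 < K ∧ ∀ a b c : ℕ, IsABCTriple a b c →
      ((a * b * c).divisors.card : ℝ) < K * (rad a b c : ℝ) ^ (10 / 3 + ε) := by
  have hSY : stewartYu1991_upperBound := stewartYu1991_of_w80Shape c₅ hW
  -- `θ = 2/3 + ε/2`, core with `ε/2`
  have hθ : (0 : ℝ) ≤ 2 / 3 + ε / 2 := by positivity
  have hsmall : ∀ ε' : ℝ, 0 < ε' → ∀ ν : ℕ, ∃ K : ℝ, 0 < K ∧ ∀ a b c : ℕ, IsABCTriple a b c →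
      (a * b * c).primeFactors.card = ν →
        ((a * b * c).divisors.card : ℝ) ≤ K * (rad a b c : ℝ) ^ (8 / 3 + (2 / 3 + ε / 2) + ε') := by
    intro ε' hε' ν
    obtain ⟨K, hK0, hK⟩ := card_divisors_le_of_w80Shape c₅ hW ε' hε' ν
    refine ⟨K, hK0, fun a b c h hν => (hK a b c h hν).trans ?_⟩
    exact mul_le_mul_of_nonneg_left
      (Real.rpow_le_rpow_of_exponent_le (one_le_rad_real a b c) (by linarith)) hK0.le
  have hlog : ∃ κ : ℝ, ∀ a b c : ℕ, IsABCTriple a b c →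
      Real.log c ≤ κ * (rad a b c : ℝ) ^ (2 / 3 + ε / 2 : ℝ) := by
    obtain ⟨κ, -, hκ⟩ := exists_log_le_mul_rpow_of_stewartYu1991 hSY (ε := ε / 2) (by positivity)
    exact ⟨κ, hκ⟩
  obtain ⟨K, hK0, hK⟩ := card_divisors_lt_of_thm_16_4_of_logBound hθ hsmall hlog h164 (ε / 2)
    (by positivity)
  refine ⟨K, hK0, fun a b c h => ?_⟩
  have := hK a b c h
  have hexp : (8 : ℝ) / 3 + (2 / 3 + ε / 2) + ε / 2 = 10 / 3 + ε := by ring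
  rwa [hexp] at this

/-- **`d(abc) ≪_ε rad(abc)^{10/3+ε}` from the typed Theorem 16.4 and the Waldschmidt-shape binder**
(the previous theorem with `h164 := pastenShimura2024_thm_16_4.freyHellegouarch`): for summit ABC,
whose cell has proved the binder, a polynomial bound for the number of divisors of `abc` resting on
ONE printed theorem (Pasten's Theorem 16.4, Shimura curves). Print's exponent `8/3 + ε`
(`pasten2024_thm_2_5`) needs in addition a `2`-adic estimate of Yu-2007 quality
(`pasten2024_thm_2_5_of_pastenShimura2024_thm_16_4_of_placeBounds`).
[cite: PastenShimura2024, Theorem 16.4 (p. 50) and Theorem 16.7 (proof, p. 51), arXiv:1705.09251v4] -/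
theorem exists_card_divisors_lt_of_pastenShimura2024_thm_16_4_of_w80Shape
    (hW : ∀ (p : ℕ), p.Prime → ∀ (S : Finset ℕ), (∀ q ∈ S, q.Prime) → p ∉ S → S.Nonempty →
      ∀ (e : ℕ → ℤ) (B : ℝ), 3 ≤ B → (∀ q ∈ S, (|e q| : ℝ) ≤ B) →
      ∏ q ∈ S, (q : ℚ) ^ e q ≠ 1 →
      (padicValRat p (∏ q ∈ S, (q : ℚ) ^ e q - 1) : ℝ) <
        (c₅ * S.card) ^ S.card * (p : ℝ) ^ 2 *
          ((Real.log B + Real.log (Real.log ((max 4 (S.sup id) : ℕ) : ℝ))) *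
            Real.log (Real.log ((max 4 (S.sup id) : ℕ) : ℝ))) *
          ∏ q ∈ S, Real.log ((max 4 q : ℕ) : ℝ))
    (h164 : pastenShimura2024_thm_16_4) (ε : ℝ) (hε : 0 < ε) :
    ∃ K : ℝ, 0 < K ∧ ∀ a b c : ℕ, IsABCTriple a b c →
      ((∏ p ∈ (a * b * c).primeFactors, ((a * b * c).factorization p + 1) : ℕ) : ℝ) <
        K * (rad a b c : ℝ) ^ (10 / 3 + ε) := by
  obtain ⟨K, hK0, hK⟩ := card_divisors_lt_of_thm_16_4_of_w80Shape c₅ hW h164.freyHellegouarch ε hε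
  refine ⟨K, hK0, fun a b c h => ?_⟩
  rw [← Nat.card_divisors h.mul_ne_zero]
  exact hK a b c h

end W80

/-! ### From the three residue-class texts of the route `PadicPrimesW80TwoThirds` -/

section W80Texts

/-- **The Waldschmidt-shape binder from the three residue-class texts** `p ≡ 3 (4)`, `p ≡ 1 (4)`,
`p = 2` (verbatim the statements `W80ThreeModFour`, `W80OneModFour`, `W80Two` of the route
`PadicPrimesW80TwoThirds` of summit ABC, all three CLOSED by the cell `abc-stewartyu`): one constant
`c₅ = max(|c₃|, |c₁|, |c₂|)` serves every prime, the tail of the bound being nonnegative (the merge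
performed by that route's deciding theorem, here producing the binder itself).
[cite: StewartYu1991, Lemma 1 (p. 226)] [cite: Waldschmidt1980, Prop 3.8 (p. 274)] -/
theorem exists_w80Shape_of_residueClassTexts
    (h₃ : ∃ c₅ : ℝ, ∀ (p : ℕ), p.Prime → p % 4 = 3 → ∀ (S : Finset ℕ), (∀ q ∈ S, q.Prime) → p ∉ S →
      S.Nonempty → ∀ (e : ℕ → ℤ) (B : ℝ), 3 ≤ B → (∀ q ∈ S, (|e q| : ℝ) ≤ B) →
      ∏ q ∈ S, (q : ℚ) ^ e q ≠ 1 →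
      (padicValRat p (∏ q ∈ S, (q : ℚ) ^ e q - 1) : ℝ) <
        (c₅ * S.card) ^ S.card * (p : ℝ) ^ 2 *
          ((Real.log B + Real.log (Real.log ((max 4 (S.sup id) : ℕ) : ℝ))) *
            Real.log (Real.log ((max 4 (S.sup id) : ℕ) : ℝ))) *
          ∏ q ∈ S, Real.log ((max 4 q : ℕ) : ℝ))
    (h₁ : ∃ c₅ : ℝ, ∀ (p : ℕ), p.Prime → p % 4 = 1 → ∀ (S : Finset ℕ), (∀ q ∈ S, q.Prime) → p ∉ S →
      S.Nonempty → ∀ (e : ℕ → ℤ) (B : ℝ), 3 ≤ B → (∀ q ∈ S, (|e q| : ℝ) ≤ B) →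
      ∏ q ∈ S, (q : ℚ) ^ e q ≠ 1 →
      (padicValRat p (∏ q ∈ S, (q : ℚ) ^ e q - 1) : ℝ) <
        (c₅ * S.card) ^ S.card * (p : ℝ) ^ 2 *
          ((Real.log B + Real.log (Real.log ((max 4 (S.sup id) : ℕ) : ℝ))) *
            Real.log (Real.log ((max 4 (S.sup id) : ℕ) : ℝ))) *
          ∏ q ∈ S, Real.log ((max 4 q : ℕ) : ℝ))
    (h₂ : ∃ c₅ : ℝ, ∀ (S : Finset ℕ), (∀ q ∈ S, q.Prime) → 2 ∉ S → S.Nonempty →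
      ∀ (e : ℕ → ℤ) (B : ℝ), 3 ≤ B → (∀ q ∈ S, (|e q| : ℝ) ≤ B) → ∏ q ∈ S, (q : ℚ) ^ e q ≠ 1 →
      (padicValRat 2 (∏ q ∈ S, (q : ℚ) ^ e q - 1) : ℝ) <
        (c₅ * S.card) ^ S.card * (2 : ℝ) ^ 2 *
          ((Real.log B + Real.log (Real.log ((max 4 (S.sup id) : ℕ) : ℝ))) *
            Real.log (Real.log ((max 4 (S.sup id) : ℕ) : ℝ))) *
          ∏ q ∈ S, Real.log ((max 4 q : ℕ) : ℝ)) :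
    ∃ c₅ : ℝ, ∀ (p : ℕ), p.Prime → ∀ (S : Finset ℕ), (∀ q ∈ S, q.Prime) → p ∉ S → S.Nonempty →
      ∀ (e : ℕ → ℤ) (B : ℝ), 3 ≤ B → (∀ q ∈ S, (|e q| : ℝ) ≤ B) →
      ∏ q ∈ S, (q : ℚ) ^ e q ≠ 1 →
      (padicValRat p (∏ q ∈ S, (q : ℚ) ^ e q - 1) : ℝ) <
        (c₅ * S.card) ^ S.card * (p : ℝ) ^ 2 *
          ((Real.log B + Real.log (Real.log ((max 4 (S.sup id) : ℕ) : ℝ))) *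
            Real.log (Real.log ((max 4 (S.sup id) : ℕ) : ℝ))) *
          ∏ q ∈ S, Real.log ((max 4 q : ℕ) : ℝ) := by
  obtain ⟨c₃, H₃⟩ := h₃
  obtain ⟨c₁, H₁⟩ := h₁
  obtain ⟨c₂, H₂⟩ := h₂
  refine ⟨max (max |c₃| |c₁|) |c₂|, ?_⟩
  intro p hp S hS hpS hne e B hB heB hne1
  -- the tail of the bound is non-negative, so the constant may be enlarged
  have h4 : (4 : ℝ) ≤ ((max 4 (S.sup id) : ℕ) : ℝ) := by exact_mod_cast le_max_left _ _
  have hlog4 : (1 : ℝ) ≤ Real.log ((max 4 (S.sup id) : ℕ) : ℝ) := by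
    have he : Real.exp 1 ≤ 4 := by have := Real.exp_one_lt_d9; linarith
    calc (1 : ℝ) = Real.log (Real.exp 1) := (Real.log_exp 1).symm
      _ ≤ Real.log 4 := Real.log_le_log (Real.exp_pos 1) he
      _ ≤ _ := Real.log_le_log (by norm_num) h4
  have hT : 0 ≤ (p : ℝ) ^ 2 * ((Real.log B + Real.log (Real.log ((max 4 (S.sup id) : ℕ) : ℝ))) *
      Real.log (Real.log ((max 4 (S.sup id) : ℕ) : ℝ))) * ∏ q ∈ S, Real.log ((max 4 q : ℕ) : ℝ) := by
    have hB' : 0 ≤ Real.log B := Real.log_nonneg (by linarith)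
    have hLL : 0 ≤ Real.log (Real.log ((max 4 (S.sup id) : ℕ) : ℝ)) := Real.log_nonneg hlog4
    have hP : 0 ≤ ∏ q ∈ S, Real.log ((max 4 q : ℕ) : ℝ) :=
      Finset.prod_nonneg fun q _ => Real.log_nonneg (by exact_mod_cast le_max_of_le_left (by norm_num))
    positivity
  have mono : ∀ c : ℝ, |c| ≤ max (max |c₃| |c₁|) |c₂| → ∀ v : ℝ,
      v < (c * S.card) ^ S.card * (p : ℝ) ^ 2 *
        ((Real.log B + Real.log (Real.log ((max 4 (S.sup id) : ℕ) : ℝ))) *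
          Real.log (Real.log ((max 4 (S.sup id) : ℕ) : ℝ))) * ∏ q ∈ S, Real.log ((max 4 q : ℕ) : ℝ) →
      v < (max (max |c₃| |c₁|) |c₂| * S.card) ^ S.card * (p : ℝ) ^ 2 *
        ((Real.log B + Real.log (Real.log ((max 4 (S.sup id) : ℕ) : ℝ))) *
          Real.log (Real.log ((max 4 (S.sup id) : ℕ) : ℝ))) * ∏ q ∈ S, Real.log ((max 4 q : ℕ) : ℝ) := by
    intro c hc v hv
    have hpow : (c * S.card) ^ S.card ≤ (max (max |c₃| |c₁|) |c₂| * S.card) ^ S.card :=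
      mul_pow_le_mul_pow_of_abs_le hc le_rfl
    refine lt_of_lt_of_le hv ?_
    have := mul_le_mul_of_nonneg_right hpow hT
    calc (c * S.card) ^ S.card * (p : ℝ) ^ 2 *
          ((Real.log B + Real.log (Real.log ((max 4 (S.sup id) : ℕ) : ℝ))) *
            Real.log (Real.log ((max 4 (S.sup id) : ℕ) : ℝ))) * ∏ q ∈ S, Real.log ((max 4 q : ℕ) : ℝ)
        = (c * S.card) ^ S.card * ((p : ℝ) ^ 2 *
          ((Real.log B + Real.log (Real.log ((max 4 (S.sup id) : ℕ) : ℝ))) *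
            Real.log (Real.log ((max 4 (S.sup id) : ℕ) : ℝ))) * ∏ q ∈ S, Real.log ((max 4 q : ℕ) : ℝ)) := by
          ring
      _ ≤ (max (max |c₃| |c₁|) |c₂| * S.card) ^ S.card * ((p : ℝ) ^ 2 *
          ((Real.log B + Real.log (Real.log ((max 4 (S.sup id) : ℕ) : ℝ))) *
            Real.log (Real.log ((max 4 (S.sup id) : ℕ) : ℝ))) * ∏ q ∈ S, Real.log ((max 4 q : ℕ) : ℝ)) :=
          this
      _ = _ := by ring
  rcases hp.eq_two_or_odd with hp2 | hodd
  · subst hp2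
    have h := H₂ S hS hpS hne e B hB heB hne1
    refine mono c₂ (le_max_right _ _) _ ?_
    simpa only [Nat.cast_ofNat] using h
  · have h13 : p % 4 = 1 ∨ p % 4 = 3 := by omega
    rcases h13 with h1 | h3
    · exact mono c₁ ((le_max_right _ _).trans (le_max_left _ _)) _
        (H₁ p hp h1 S hS hpS hne e B hB heB hne1)
    · exact mono c₃ ((le_max_left _ _).trans (le_max_left _ _)) _
        (H₃ p hp h3 S hS hpS hne e B hB heB hne1)

/-- **`d(abc) < K_ε rad(abc)^{10/3+ε}` from Pasten's Theorem 16.4 and the three residue-class texts**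
(`W80ThreeModFour`, `W80OneModFour`, `W80Two` of the route `PadicPrimesW80TwoThirds`, summit ABC —
all CLOSED; with their proofs `padicPrimesW80TwoThirds_w80ThreeModFour_proof`, `…_w80OneModFour_proof`,
`…_w80Two_proof` this is, cell-side, a bound resting on the typed fact `pastenShimura2024_thm_16_4`
ALONE). [cite: PastenShimura2024, Theorem 16.4 (p. 50) and Theorem 16.7 (proof, p. 51), arXiv:1705.09251v4]
[cite: StewartYu1991, Theorem (p. 226)] -/
theorem exists_card_divisors_lt_of_pastenShimura2024_thm_16_4_of_w80Texts
    (h₃ : ∃ c₅ : ℝ, ∀ (p : ℕ), p.Prime → p % 4 = 3 → ∀ (S : Finset ℕ), (∀ q ∈ S, q.Prime) → p ∉ S →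
      S.Nonempty → ∀ (e : ℕ → ℤ) (B : ℝ), 3 ≤ B → (∀ q ∈ S, (|e q| : ℝ) ≤ B) →
      ∏ q ∈ S, (q : ℚ) ^ e q ≠ 1 →
      (padicValRat p (∏ q ∈ S, (q : ℚ) ^ e q - 1) : ℝ) <
        (c₅ * S.card) ^ S.card * (p : ℝ) ^ 2 *
          ((Real.log B + Real.log (Real.log ((max 4 (S.sup id) : ℕ) : ℝ))) *
            Real.log (Real.log ((max 4 (S.sup id) : ℕ) : ℝ))) *
          ∏ q ∈ S, Real.log ((max 4 q : ℕ) : ℝ))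
    (h₁ : ∃ c₅ : ℝ, ∀ (p : ℕ), p.Prime → p % 4 = 1 → ∀ (S : Finset ℕ), (∀ q ∈ S, q.Prime) → p ∉ S →
      S.Nonempty → ∀ (e : ℕ → ℤ) (B : ℝ), 3 ≤ B → (∀ q ∈ S, (|e q| : ℝ) ≤ B) →
      ∏ q ∈ S, (q : ℚ) ^ e q ≠ 1 →
      (padicValRat p (∏ q ∈ S, (q : ℚ) ^ e q - 1) : ℝ) <
        (c₅ * S.card) ^ S.card * (p : ℝ) ^ 2 *
          ((Real.log B + Real.log (Real.log ((max 4 (S.sup id) : ℕ) : ℝ))) *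
            Real.log (Real.log ((max 4 (S.sup id) : ℕ) : ℝ))) *
          ∏ q ∈ S, Real.log ((max 4 q : ℕ) : ℝ))
    (h₂ : ∃ c₅ : ℝ, ∀ (S : Finset ℕ), (∀ q ∈ S, q.Prime) → 2 ∉ S → S.Nonempty →
      ∀ (e : ℕ → ℤ) (B : ℝ), 3 ≤ B → (∀ q ∈ S, (|e q| : ℝ) ≤ B) → ∏ q ∈ S, (q : ℚ) ^ e q ≠ 1 →
      (padicValRat 2 (∏ q ∈ S, (q : ℚ) ^ e q - 1) : ℝ) <
        (c₅ * S.card) ^ S.card * (2 : ℝ) ^ 2 *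
          ((Real.log B + Real.log (Real.log ((max 4 (S.sup id) : ℕ) : ℝ))) *
            Real.log (Real.log ((max 4 (S.sup id) : ℕ) : ℝ))) *
          ∏ q ∈ S, Real.log ((max 4 q : ℕ) : ℝ))
    (h164 : pastenShimura2024_thm_16_4) (ε : ℝ) (hε : 0 < ε) :
    ∃ K : ℝ, 0 < K ∧ ∀ a b c : ℕ, IsABCTriple a b c →
      ((a * b * c).divisors.card : ℝ) < K * (rad a b c : ℝ) ^ (10 / 3 + ε) := by
  obtain ⟨c₅, hW⟩ := exists_w80Shape_of_residueClassTexts h₃ h₁ h₂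
  exact card_divisors_lt_of_thm_16_4_of_w80Shape c₅ hW h164.freyHellegouarch ε hε

end W80Texts

/-! ### Print's exponent `8/3 + ε` from Theorem 16.4 (ii), the Waldschmidt-shape binder and the
`2`-ADIC place bounds only -/

section TwoAdic

variable (c₅ : ℝ)

/-- **The valuation-product `abc` rung `pasten2024_thm_2_5` (`d(abc) ≪_ε rad^{8/3+ε}`) from
Theorem 16.4 (ii), the Waldschmidt-shape binder `hW` (small `ω`: `card_divisors_le_of_w80Shape`;
and `log c ≪ rad`, Stewart–Yu 1991) and the two place bounds AT `p = 2` ONLY** (`hpad2`, `hpadc2`: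
Lemma 15.2 through `factorization_two_lt_of_twoAdicPlaceBounds`). For summit ABC: `hW` is proved
(route `PadicPrimesW80TwoThirds`), and the `2`-adic bounds are the text `Y07Two` of the route
`PadicPrimesKummerThird` through the cell's `placeBound_a_of_y07At` / `placeBound_c_of_y07At` at
`p = 2` — so along this road the rung rests on {Theorem 16.4, `Y07Two`}.
[cite: PastenShimura2024, Theorem 16.7 with its proof (§16.4, arXiv:1705.09251v4 p. 51)]
[cite: StewartYu1991, Theorem (p. 226) and §3] -/
theorem pasten2024_thm_2_5_of_thm_16_4_of_w80Shape_of_twoAdicPlaceBounds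
    (hW : ∀ (p : ℕ), p.Prime → ∀ (S : Finset ℕ), (∀ q ∈ S, q.Prime) → p ∉ S → S.Nonempty →
      ∀ (e : ℕ → ℤ) (B : ℝ), 3 ≤ B → (∀ q ∈ S, (|e q| : ℝ) ≤ B) →
      ∏ q ∈ S, (q : ℚ) ^ e q ≠ 1 →
      (padicValRat p (∏ q ∈ S, (q : ℚ) ^ e q - 1) : ℝ) <
        (c₅ * S.card) ^ S.card * (p : ℝ) ^ 2 *
          ((Real.log B + Real.log (Real.log ((max 4 (S.sup id) : ℕ) : ℝ))) *
            Real.log (Real.log ((max 4 (S.sup id) : ℕ) : ℝ))) *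
          ∏ q ∈ S, Real.log ((max 4 q : ℕ) : ℝ))
    {K : ℝ} (hK : 1 ≤ K)
    (hpad2 : ∀ {a b c : ℕ}, IsABCTriple a b c → 2 ∣ a →
      (a.factorization 2 : ℝ) * Real.log 2 < theta K b c 0 *
        ((2 / Real.log 2) * (Real.log 2 + Real.log (max (Real.exp 1) (2 * Real.log c)))))
    (hpadc2 : ∀ {a b c : ℕ}, IsABCTriple a b c → 1 < a * b → 2 ∣ c →
      (c.factorization 2 : ℝ) * Real.log 2 < theta K a b 0 *
        ((2 / Real.log 2) * (Real.log 2 + Real.log (max (Real.exp 1) (2 * Real.log c)))))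
    (h164 : ∀ ε : ℝ, 0 < ε → ∃ N₀ : ℕ, ∀ (W : WeierstrassCurve ℚ) [W.IsElliptic],
      IsFreyHellegouarch W → N₀ ≤ W.conductorNorm ℤ →
        ∀ D M : ℕ, IsAdmissibleFactorization (W.conductorNorm ℤ) D M →
          2 ≤ (M.primeFactors.erase 2).card →
            ((∏ p ∈ D.primeFactors, (W.minimalDiscriminantNorm ℤ).factorization p : ℕ) : ℝ)
              < (W.conductorNorm ℤ : ℝ) ^ ((8 : ℝ) / 3 + ε) * (M : ℝ)) :
    pasten2024_thm_2_5 := by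
  refine pasten2024_thm_2_5_of_card_divisors_lt fun ε hε => ?_
  obtain ⟨κ₁, hκ₁1, hκ₁⟩ := exists_log_le_mul_rad_of_stewartYu1991 (stewartYu1991_of_w80Shape c₅ hW)
  have hlog1 : ∀ a b c : ℕ, IsABCTriple a b c → Real.log c ≤ κ₁ * (rad a b c : ℝ) ^ 1 :=
    fun a b c h => by simpa only [pow_one] using hκ₁ a b c h
  have h152 := factorization_two_lt_of_twoAdicPlaceBounds hK hpad2 hpadc2
    (exists_log_max_exp_le_mul_rpow_of_log_le_mul_pow hκ₁1 hlog1)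
  have hsmall : ∀ ν : ℕ, ∃ K : ℝ, 0 < K ∧ ∀ a b c : ℕ, IsABCTriple a b c →
      (a * b * c).primeFactors.card = ν →
        ((a * b * c).divisors.card : ℝ) ≤ K * (rad a b c : ℝ) ^ (8 / 3 + 0 + ε) := by
    intro ν
    obtain ⟨K, hK0, hKν⟩ := card_divisors_le_of_w80Shape c₅ hW ε hε ν
    refine ⟨K, hK0, fun a b c h hν => (hKν a b c h hν).trans ?_⟩
    exact mul_le_mul_of_nonneg_left
      (Real.rpow_le_rpow_of_exponent_le (one_le_rad_real a b c) (by linarith)) hK0.le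
  have htwo : ∃ C₂ : ℝ, 0 < C₂ ∧ ∀ a b c : ℕ, IsABCTriple a b c →
      (((a * b * c).factorization 2 : ℕ) : ℝ) + 1 ≤ C₂ * (rad a b c : ℝ) ^ ((0 : ℝ) + ε / 4) := by
    obtain ⟨C, hC1, hC⟩ := h152 (ε / 4) (by positivity)
    refine ⟨C + 1, by linarith, fun a b c h => ?_⟩
    have h1 := hC a b c h
    have hR : (1 : ℝ) ≤ (rad a b c : ℝ) ^ (ε / 4) := Real.one_le_rpow (one_le_rad_real a b c) (by positivity)
    rw [zero_add]
    nlinarith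
  obtain ⟨K', hK0, hK'⟩ :=
    card_divisors_lt_of_thm_16_4_core hε hsmall htwo (h164 (ε / 4) (by positivity))
  exact ⟨K', hK0, fun a b c h => by simpa only [add_zero] using hK' a b c h⟩

/-- **The rung BY NAME from the typed Theorem 16.4, the three residue-class texts and the
`2`-adic place bounds** — for summit ABC: `pasten2024_thm_2_5` ⇐ {`pastenShimura2024_thm_16_4`,
`Y07Two`} (the W80 texts being closed). [cite: PastenShimura2024, Theorem 16.7 with its proof (§16.4, arXiv:1705.09251v4 p. 51)] -/
theorem pasten2024_thm_2_5_of_pastenShimura2024_thm_16_4_of_w80Texts_of_twoAdicPlaceBounds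
    (h₃ : ∃ c₅ : ℝ, ∀ (p : ℕ), p.Prime → p % 4 = 3 → ∀ (S : Finset ℕ), (∀ q ∈ S, q.Prime) → p ∉ S →
      S.Nonempty → ∀ (e : ℕ → ℤ) (B : ℝ), 3 ≤ B → (∀ q ∈ S, (|e q| : ℝ) ≤ B) →
      ∏ q ∈ S, (q : ℚ) ^ e q ≠ 1 →
      (padicValRat p (∏ q ∈ S, (q : ℚ) ^ e q - 1) : ℝ) <
        (c₅ * S.card) ^ S.card * (p : ℝ) ^ 2 *
          ((Real.log B + Real.log (Real.log ((max 4 (S.sup id) : ℕ) : ℝ))) *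
            Real.log (Real.log ((max 4 (S.sup id) : ℕ) : ℝ))) *
          ∏ q ∈ S, Real.log ((max 4 q : ℕ) : ℝ))
    (h₁ : ∃ c₅ : ℝ, ∀ (p : ℕ), p.Prime → p % 4 = 1 → ∀ (S : Finset ℕ), (∀ q ∈ S, q.Prime) → p ∉ S →
      S.Nonempty → ∀ (e : ℕ → ℤ) (B : ℝ), 3 ≤ B → (∀ q ∈ S, (|e q| : ℝ) ≤ B) →
      ∏ q ∈ S, (q : ℚ) ^ e q ≠ 1 →
      (padicValRat p (∏ q ∈ S, (q : ℚ) ^ e q - 1) : ℝ) <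
        (c₅ * S.card) ^ S.card * (p : ℝ) ^ 2 *
          ((Real.log B + Real.log (Real.log ((max 4 (S.sup id) : ℕ) : ℝ))) *
            Real.log (Real.log ((max 4 (S.sup id) : ℕ) : ℝ))) *
          ∏ q ∈ S, Real.log ((max 4 q : ℕ) : ℝ))
    (h₂ : ∃ c₅ : ℝ, ∀ (S : Finset ℕ), (∀ q ∈ S, q.Prime) → 2 ∉ S → S.Nonempty →
      ∀ (e : ℕ → ℤ) (B : ℝ), 3 ≤ B → (∀ q ∈ S, (|e q| : ℝ) ≤ B) → ∏ q ∈ S, (q : ℚ) ^ e q ≠ 1 →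
      (padicValRat 2 (∏ q ∈ S, (q : ℚ) ^ e q - 1) : ℝ) <
        (c₅ * S.card) ^ S.card * (2 : ℝ) ^ 2 *
          ((Real.log B + Real.log (Real.log ((max 4 (S.sup id) : ℕ) : ℝ))) *
            Real.log (Real.log ((max 4 (S.sup id) : ℕ) : ℝ))) *
          ∏ q ∈ S, Real.log ((max 4 q : ℕ) : ℝ))
    {K : ℝ} (hK : 1 ≤ K)
    (hpad2 : ∀ {a b c : ℕ}, IsABCTriple a b c → 2 ∣ a →
      (a.factorization 2 : ℝ) * Real.log 2 < theta K b c 0 *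
        ((2 / Real.log 2) * (Real.log 2 + Real.log (max (Real.exp 1) (2 * Real.log c)))))
    (hpadc2 : ∀ {a b c : ℕ}, IsABCTriple a b c → 1 < a * b → 2 ∣ c →
      (c.factorization 2 : ℝ) * Real.log 2 < theta K a b 0 *
        ((2 / Real.log 2) * (Real.log 2 + Real.log (max (Real.exp 1) (2 * Real.log c)))))
    (h164 : pastenShimura2024_thm_16_4) : pasten2024_thm_2_5 := by
  obtain ⟨c₅, hW⟩ := exists_w80Shape_of_residueClassTexts h₃ h₁ h₂
  exact pasten2024_thm_2_5_of_thm_16_4_of_w80Shape_of_twoAdicPlaceBounds c₅ hW hK hpad2 hpadc2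
    h164.freyHellegouarch

end TwoAdic

end Literature.NumberTheory.DiophantineGeometry

end
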